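import Literature.AlgebraicGeometry.ModuliOfAbelianVarieties.SiegelFamilyRefinedHumbertInvariant
import Literature.Geometry.Kaehler.ComplexTorusRefinedHumbertEllipticCurves
import HarnessLib

/-!
# `Z ∈ 𝔥₂` satisfies a PRIMITIVE singular relation of invariant `δ²` iff `X_Z` contains an elliptic curve of
# degree exactly `δ` (Kani 1994: `H_{δ²} = {q_{(A,θ)} → δ²}`; Birkenhake–Wilhelm 2003, Prop. 4.8, the degree clause)

Layer `Literature/AlgebraicGeometry/ModuliOfAbelianVarieties`, namespace `…SiegelModuli`; lane `lit-hodgefound`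
(Track 2 foundations library, Layer A4), row **A4-62** (seat skel-4), FILE 4 — the junction of FILE 2
(`SiegelFamilyRefinedHumbertInvariant`: on `X_Z`, `q̃_{θ_Z}(D) = Δ(q(D))`) and FILE 3
(`ComplexTorusRefinedHumbertEllipticCurves`: Kani's theorem — elliptic curves of degree `d` ↔ primitive classes of
`NS/ℤθ` with `q̃ = d²`) with rows A4-59/A4-60/A4-61‴ (Humbert loci `H_q`, `H_Δ(𝔥₂)`; `Z ∈ ⋃_{δ>0} H_{δ²}` iff `X_Z`
contains an elliptic curve, the value of `δ` left open; an elliptic curve of degree `δ` puts `Z` on `H_{δ²}`).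
It settles the DEGREE: primitive relations of invariant `δ²` ⟷ elliptic curves of degree exactly `δ`.

## Sources, VERBATIM

Ch. Birkenhake, H. Wilhelm, *Humbert surfaces and the Kummer plane*, Trans. AMS **355** (2003) [BirkenhakeWilhelm2003],
§4 Prop. 4.8 and its proof (p. 1830): "The Humbert surface `H_{δ²}` is the locus of principally polarized abelian
surfaces `(X, L₀) ∈ 𝒜₂` admitting an isogeny of degree `δ²`, `(E₁ × E₂, p₁^*𝒪_{E₁}(δ) ⊗ p₂^*𝒪_{E₂}(δ)) → (X, L₀)`
[…] Conversely suppose `(X, L₀) ∈ H_{δ²}`. […] its connected component `E₁` containing `0` is an elliptic curve.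
Using [7] 2.3 we see that `deg L₀|E₁ = δ`." ([7] = Kani 1994.)

E. Kani, *The moduli spaces of Jacobians isomorphic to a product of two elliptic curves*, Collect. Math. 67 (2016)
[Kani2016ModuliJacobiansProductElliptic], as quoted in arXiv:2602.14319 §6 (6.1) (p0025):
"`H_N = {⟨A,θ⟩ ∈ 𝒜₂(K) : q_{(A,θ)} → N}`", with (p0007 L61) "if `x ∈ R(q)` and `x` is primitive, i.e., the gcd of
the entries in the vector `x` is `1`, then we say that `q` represents primitively `x`, and we write `q → x`";
E. Kani, *Elliptic curves on abelian surfaces*, Manuscripta Math. 84 (1994) [Kani1994EllipticCurvesAbelianSurfaces]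
(elliptic curves of degree `d` ↔ primitive classes of norm `d²` in `NS(A,θ)`; R. Auffarth, arXiv:1507.08617
[Auffarth2015EllipticCurvesAbelianVarieties], Thm. 1.2 for `n = 2` — FILE 3).

## Statement formalized (`Z ∈ 𝔥₂`, `X_Z = ℂ²/(Z 1₂)ℤ⁴`, `θ_Z = E_Z` principal, lattice basis `(x₁,x₂,y₁,y₂) = stdIdx`)

A relation `q ∈ ℤ⁵` is PRIMITIVE if `q = m q′`, `q′ ∈ ℤ⁵`, forces `m = ±1`; a class `D ∈ NS(X_Z)` is primitive mod
`θ_Z` if `D = kD′ + sθ_Z`, `D′ ∈ NS(X_Z)`, forces `k = ±1` (FILE 3). An elliptic curve `Y ⊂ X_Z` is a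
`SubtorusFrame (prinPeriod Z) 2` (positively oriented saturated frame `λ′₀, λ′₁`), of degree
`deg Y = (Y·θ_Z) = −E_Z(Φλ′₀, Φλ′₁) ∈ ℤ_{>0}` (row A4-61‴ `exists_pos_degree`).

* §0 `SubtorusFrame.exists_ofSubspace_cycleForm_eq`: every subtorus frame `Y` has the class of the frame
  `SubtorusFrame.ofSubspace` of its own tangent lattice subspace `Φ⁻¹(T_Y)` (bridge to the `W`-presentation of rows
  A4-61 / FILE 3); `humbertVector` of `kD + sθ_Z` is `k·q(D)` (`q(θ_Z) = 0`).
* §1 **primitive relations ↔ primitive classes**: if `q(D) = q` is primitive then `D` is primitive mod `θ_Z`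
  (`primitive_mod_of_humbertVector_primitive`); conversely for `D ∈ NS(X_Z)` primitive mod `θ_Z` its relation
  `q(D)` is primitive (`humbertVector_primitive_of_primitive_mod`: a divisor `m` of `q(D)` gives the class
  `γ_{q(D)/m} ∈ NS(X_Z)` with `D − mγ ∈ ℚθ_Z ∩ NS = ℤθ_Z`).
* §2 **(⟹) `exists_ellipticCurve_degree_eq_of_primitive`**: `q` primitive, `Δ(q) = δ²`, `δ > 0`, `Z ∈ H_q` ⟹ `X_Z`
  contains an elliptic curve of degree EXACTLY `δ` (the class `γ_q ∈ NS(X_Z)` is primitive mod `θ_Z` with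
  `q̃(γ_q) = Δ(q) = δ²`, FILE 2; then FILE 3 = Kani's theorem).
* §3 **(⟸) `exists_primitive_relation_of_ellipticCurve`**: an elliptic curve `Y ⊂ X_Z` of degree `δ` yields a
  PRIMITIVE relation `q = q([Y])` of `Z` with `Δ(q) = δ²` (row A4-61‴ gave some non-trivial relation of invariant `δ²`;
  primitivity is FILE 3's Lemma 3.7 transported by §1).
* §4 **`exists_primitive_relation_sq_iff_exists_ellipticCurve_degree_eq`**: for `δ > 0`,
  **`(∃ q ∈ ℤ⁵ primitive, Δ(q) = δ², Z ∈ H_q) ⟺ (∃ an elliptic curve Y ⊂ X_Z with deg Y = δ)`** — Kani's `H_{δ²}`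
  (primitive representation) is the locus of an elliptic curve of degree exactly `δ`; B–W's "`deg L₀|E₁ = δ`".

## Scope (NOT formalised here)

The isogeny `E₁ × E₂ → X` of degree `δ²` and the complementary curve `E₂` of B–W (12) (row A4-60 treats the isogeny
without degrees; p09's `ComplexTorusComplementarySubtorusDegrees` the complementary degree), `𝒜₂ = Sp₄(ℤ)\𝔥₂`.

## References

* [Kani1994EllipticCurvesAbelianSurfaces] E. Kani, *Elliptic curves on abelian surfaces*, Manuscripta Math. 84 (1994).
* [Kani2016ModuliJacobiansProductElliptic] E. Kani, *The moduli spaces of Jacobians isomorphic to a product of two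
  elliptic curves*, Collect. Math. 67 (2016) (`H_N` via `q_{(A,θ)} → N`).
* [BirkenhakeWilhelm2003] Ch. Birkenhake, H. Wilhelm, *Humbert surfaces and the Kummer plane*, Trans. AMS 355 (2003),
  §4 Prop. 4.8 (p. 1830).
* [Auffarth2015EllipticCurvesAbelianVarieties] R. Auffarth, *Elliptic curves on abelian varieties* (2015), Thm. 1.2,
  Lemma 3.7, Thm. 3.9.
* [KaniCurvesGenus2AbelianSurfaces] E. Kani, *Curves of genus 2 on abelian surfaces*, §2 (11).
* [Lange2023AbelianVarietiesComplex] H. Lange, *Abelian Varieties over the Complex Numbers* (2023), §1.1.6 Exercise (2)(a),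
  §3.1.1.
-/

noncomputable section

set_option maxSynthPendingDepth 3

open Module Function Complex Matrix Set Sum

namespace Literature.AlgebraicGeometry.ModuliOfAbelianVarieties

namespace SiegelModuli

open Literature.NumberTheory.Automorphic (siegelUpperHalfSpace)
open Literature.NumberTheory.ModularForms.SiegelUpperHalfSpace
open Literature.Geometry.Kaehler Literature.Geometry.Kaehler.ComplexTorus
open Literature.Analysis.Complex Literature.LinearAlgebra.Alternating

/-! ## §0 Bridges: every subtorus frame is an `ofSubspace` frame in class; `q(kD + sθ_Z) = k q(D)` -/

/-- **Every subtorus datum `Y` has the cycle class of the `W`-presented frame of its tangent lattice subspace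
`W = Φ⁻¹(T_Y)`** (`SubtorusFrame.ofSubspace`, positively oriented enumeration): the class depends only on the
oriented complex subtorus (row A4-18 `cycleForm_eq_of_realSpan_eq`). Bridge from arbitrary frames (rows A4-18,
A4-61‴) to the `W`-presentation of rows A4-61 / A4-62 FILE 3.
[cite: Lange2023AbelianVarietiesComplex, §1.1.6 Exercise (2)(a) (p. 26)] [cite: VoisinHodgeI2002, §11.1.2 Cor. 11.15 and Remark 11.16] -/
theorem _root_.Literature.Geometry.Kaehler.ComplexTorus.SubtorusFrame.exists_ofSubspace_cycleForm_eq
    {ι : Type*} [Fintype ι] [DecidableEq ι] {E : Type*} [NormedAddCommGroup E] [NormedSpace ℂ E]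
    (Φ : (ι → ℝ) ≃L[ℝ] E) {m k : ℕ} (Y : SubtorusFrame Φ m) (e : Fin (m + k) ≃ ι) :
    ∃ (W : Submodule ℝ (ι → ℝ)) (hW : IsLatticeSubspace W) (hWc : IsComplexSubspace Φ W)
      (eY : Fin m ≃ Fin (subRank W)) (hpos : orientationSign (subtorusPeriod Φ W hW hWc) eY = 1),
      Y.realSpan = W.map (Φ : (ι → ℝ) →ₗ[ℝ] E) ∧
        Y.cycleForm e = (SubtorusFrame.ofSubspace Φ W hW hWc eY hpos).cycleForm e := by
  have hW := Y.isLatticeSubspace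
  have hWc := Y.isComplexSubspace
  have hYW : Y.realSpan = (Y.realSpan.comap (Φ : (ι → ℝ) →ₗ[ℝ] E)).map (Φ : (ι → ℝ) →ₗ[ℝ] E) :=
    (Submodule.map_comap_eq_of_surjective Φ.surjective _).symm
  have hm : m = subRank (Y.realSpan.comap (Φ : (ι → ℝ) →ₗ[ℝ] E)) :=
    SubtorusFrame.eq_subRank_of_realSpan_eq_map Φ _ hW Y hYW
  obtain ⟨eY, hpos⟩ := exists_orientationSign_subtorusPeriod_eq_one_of_equiv Φ _ hW hWc (finCongr hm)
  refine ⟨_, hW, hWc, eY, hpos, hYW, ?_⟩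
  exact Y.cycleForm_eq_of_realSpan_eq _ (by rw [SubtorusFrame.realSpan_ofSubspace]; exact hYW) e

variable (Z : siegelUpperHalfSpace 2)

/-- `latticeForm` is additive. [folklore] -/
private theorem latticeForm_add' {k : ℕ} (γ γ' : (Fin 2 → ℂ) [⋀^Fin k]→L[ℝ] ℂ) :
    latticeForm Z (γ + γ') = latticeForm Z γ + latticeForm Z γ' := by
  ext v
  rfl

/-- `latticeForm` is `ℂ`-homogeneous. [folklore] -/
private theorem latticeForm_smul' {k : ℕ} (c : ℂ) (γ : (Fin 2 → ℂ) [⋀^Fin k]→L[ℝ] ℂ) :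
    latticeForm Z (c • γ) = c • latticeForm Z γ := by
  ext v
  rfl

/-- **`q(kD + sθ_Z) = k · q(D)`**: the Humbert vector is additive and vanishes on the polarisation (`q(E_Z) = 0`, row
A4-59 `humbertVector_prinForm`). [cite: BirkenhakeWilhelm2003, §4 eq. (8) and Prop. 4.7 (pp. 1827–1830)] -/
theorem humbertVector_zsmul_add_zsmul_prinForm (k s : ℤ) (D : (Fin 2 → ℂ) [⋀^Fin 2]→L[ℝ] ℝ) :
    humbertVector (latticeForm Z (ofRealForm (k • D + s • prinForm Z))) =
      (k : ℂ) • humbertVector (latticeForm Z (ofRealForm D)) := by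
  rw [ComplexTorus.ofRealForm_add, ofRealForm_zsmul, ofRealForm_zsmul, latticeForm_add', latticeForm_smul',
    latticeForm_smul', humbertVector_add, humbertVector_smul, humbertVector_smul, humbertVector_prinForm, smul_zero, add_zero]

/-! ## §1 Primitive relations ↔ classes primitive modulo `θ_Z` -/

/-- **A class whose singular relation is PRIMITIVE is primitive in `NS(X_Z)/ℤθ_Z`**: if `q(D) = q` with `q ∈ ℤ⁵`
primitive and `D = kD′ + sθ_Z` with `D′ ∈ NS(X_Z)`, then `q = k·q(D′)` with `q(D′) ∈ ℤ⁵`, so `k = ±1`.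
[cite: Kani2016ModuliJacobiansProductElliptic, (`q_{(A,θ)} → N`, primitive representation; quoted in arXiv:2602.14319 (6.1))] [cite: BirkenhakeWilhelm2003, §4 eq. (8) (p. 1827)] -/
theorem primitive_mod_of_humbertVector_primitive {D : (Fin 2 → ℂ) [⋀^Fin 2]→L[ℝ] ℝ} {q : Fin 5 → ℤ}
    (hq : humbertVector (latticeForm Z (ofRealForm D)) = fun i ↦ (q i : ℂ))
    (hprim : ∀ (m : ℤ) (q' : Fin 5 → ℤ), q = m • q' → m = 1 ∨ m = -1)
    (k s : ℤ) (D' : (Fin 2 → ℂ) [⋀^Fin 2]→L[ℝ] ℝ) (hD' : IsNSForm (prinPeriod Z) D')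
    (h : D = k • D' + s • prinForm Z) : k = 1 ∨ k = -1 := by
  obtain ⟨q', hq'⟩ :=
    exists_int_humbertVector_of_mem_integralForms (ofRealForm_mem_integralForms_two (prinPeriod Z) hD')
  refine hprim k q' (funext fun i ↦ ?_)
  have hc := congrFun hq i
  rw [h, humbertVector_zsmul_add_zsmul_prinForm, hq', Pi.smul_apply, smul_eq_mul] at hc
  rw [Pi.smul_apply, smul_eq_mul]
  exact_mod_cast hc.symm

/-- **Conversely, a class `D ∈ NS(X_Z)` primitive in `NS(X_Z)/ℤθ_Z` has a PRIMITIVE singular relation `q(D)`.** If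
`q(D) = m q′` with `m ≠ ±1`: for `m = 0`, `D ∈ ℚθ_Z ∩ NS = ℤθ_Z` (row A4-59 `humbertVector_eq_zero_iff_mem_span`,
FILE 1: `θ` primitive in `NS`), contradicting primitivity; for `m ≠ 0`, `q′` is again a relation of `Z`, its class
`γ_{q′} ∈ NS(X_Z)` (row A4-59 `humbertClass`) has `q(D − mγ_{q′}) = 0`, so `D − mγ_{q′} ∈ ℤθ_Z` and `D = mγ_{q′} + sθ_Z`
forces `m = ±1`. [cite: Kani1994EllipticCurvesAbelianSurfaces] [cite: BirkenhakeWilhelm2003, §4 Cor. 4.6 and Prop. 4.7 (pp. 1829–1830)] -/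
theorem humbertVector_primitive_of_primitive_mod {D : (Fin 2 → ℂ) [⋀^Fin 2]→L[ℝ] ℝ}
    (hD : IsNSForm (prinPeriod Z) D) {q : Fin 5 → ℤ}
    (hq : humbertVector (latticeForm Z (ofRealForm D)) = fun i ↦ (q i : ℂ))
    (hind : ∀ (k s : ℤ) (D' : (Fin 2 → ℂ) [⋀^Fin 2]→L[ℝ] ℝ), IsNSForm (prinPeriod Z) D' →
      D = k • D' + s • prinForm Z → k = 1 ∨ k = -1)
    (m : ℤ) (q' : Fin 5 → ℤ) (h : q = m • q') : m = 1 ∨ m = -1 := by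
  classical
  have hγI := ofRealForm_mem_integralForms_two (prinPeriod Z) hD
  have hγR := mem_rationalForms_of_mem_integralForms _ hγI
  have hγH := ofRealForm_mem_hodgeClasses_one (prinPeriod Z) hD
  -- a class `G' ∈ NS(X_Z)` with `q(D) = m · q(G')`
  obtain ⟨G', hG', hDG⟩ : ∃ G' : (Fin 2 → ℂ) [⋀^Fin 2]→L[ℝ] ℝ, IsNSForm (prinPeriod Z) G' ∧
      humbertVector (latticeForm Z (ofRealForm D)) = (m : ℂ) • humbertVector (latticeForm Z (ofRealForm G')) := by
    by_cases hm : m = 0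
    · refine ⟨0, isNSForm_zero (prinPeriod Z), ?_⟩
      rw [hq, h, hm]
      funext i
      simp
    · -- `q'` is a relation of `Z`; take the class `γ_{q'}`
      have hrel : singularRelation (fun i ↦ (q i : ℂ)) (Z : Matrix (Fin 2) (Fin 2) ℂ) = 0 := by
        rw [← hq]
        exact (mem_hodgeClasses_iff_singularRelation_eq_zero Z hγR).1 hγH
      have hrel' : singularRelation (fun i ↦ (q' i : ℂ)) (Z : Matrix (Fin 2) (Fin 2) ℂ) = 0 := by
        have hqq : (fun i ↦ (q i : ℂ)) = (m : ℂ) • fun i ↦ (q' i : ℂ) := by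
          funext i
          rw [h, Pi.smul_apply, Pi.smul_apply, smul_eq_mul, smul_eq_mul, Int.cast_mul]
        rw [hqq, singularRelation_smul] at hrel
        exact (mul_eq_zero.1 hrel).resolve_left (Int.cast_ne_zero.2 hm)
      have hIH : humbertClass Z q' ∈ integralHodgeClasses (prinPeriod Z) 1 :=
        (mem_integralHodgeClasses_iff (prinPeriod Z)).2
          ⟨humbertClass_mem_integralForms Z q',
            ((mem_hodgeClasses_iff (prinPeriod Z)).1 (humbertClass_mem_hodgeClasses hrel')).2⟩
      obtain ⟨G', hG'NS, hG'γ⟩ := (mem_integralHodgeClasses_one_iff_exists (prinPeriod Z)).1 hIH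
      refine ⟨G', (mem_neronSeveriGroup_iff (prinPeriod Z)).1 hG'NS, ?_⟩
      rw [hG'γ, humbertVector_humbertClass, hq]
      funext i
      rw [h, Pi.smul_apply, Pi.smul_apply, smul_eq_mul, smul_eq_mul, Int.cast_mul]
  -- `q(D - m G') = 0`, so `D - m G' ∈ ℚθ_Z`
  have hNS : IsNSForm (prinPeriod Z) ((1 : ℤ) • D + (-m) • G') := hD.zsmul_add_zsmul (prinPeriod Z) hG' 1 (-m)
  rw [one_zsmul] at hNS
  have h0 : humbertVector (latticeForm Z (ofRealForm (D + (-m) • G'))) = 0 := by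
    rw [ComplexTorus.ofRealForm_add, ofRealForm_zsmul, latticeForm_add', latticeForm_smul', humbertVector_add,
      humbertVector_smul, hDG, Int.cast_neg, neg_smul, add_neg_cancel]
  have hspan := (humbertVector_eq_zero_iff_mem_span Z
    (mem_rationalForms_of_mem_integralForms _ (ofRealForm_mem_integralForms_two (prinPeriod Z) hNS))).1 h0
  obtain ⟨r, hr⟩ := Submodule.mem_span_singleton.1 hspan
  -- `D - m G' = r θ_Z` with `r ∈ ℚ`, hence `r ∈ ℤ`
  have hreal : D + (-m) • G' = (r : ℝ) • prinForm Z := by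
    apply ofRealForm_injective
    rw [← hr, ComplexTorus.ofRealForm_smul, Complex.ofReal_ratCast, Rat.cast_smul_eq_qsmul]
  have hrNS : IsNSForm (prinPeriod Z) ((r : ℝ) • prinForm Z) := by rwa [hreal] at hNS
  obtain ⟨s, hs⟩ := (isPrincipalPolarization_prinForm Z).exists_int_of_smul_isNSForm (prinPeriod Z) stdIdx hrNS
  refine hind m s G' hG' ?_
  rw [← Int.cast_smul_eq_zsmul ℝ s, ← hs, ← hreal, neg_smul]
  abel

/-! ## §2 A primitive relation of invariant `δ²` gives an elliptic curve of degree exactly `δ` -/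

/-- **(⟹) KANI / B–W PROP. 4.8, THE DEGREE: if `Z ∈ 𝔥₂` satisfies a PRIMITIVE singular relation `q` with
`Δ(q) = δ²`, `δ > 0`, then `X_Z` contains an elliptic curve `Y` of degree EXACTLY `δ`** (`deg Y = −E_Z(Φλ′₀, Φλ′₁) = δ`).
Proof: the integral Hodge class `γ_q ∈ NS(X_Z)` (row A4-59) is primitive mod `θ_Z` (§1) with
`q̃_{θ_Z}(γ_q) = Δ(q) = δ²` (FILE 2), so Kani's theorem (FILE 3 `IsPrincipalPolarization.exists_ellipticCurve_degree_eq_iff`)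
produces the curve. [cite: BirkenhakeWilhelm2003, §4 Prop. 4.8 and its proof ("Using [7] 2.3 we see that `deg L₀|E₁ = δ`", p. 1830)] [cite: Kani1994EllipticCurvesAbelianSurfaces] [cite: Kani2016ModuliJacobiansProductElliptic, (`H_N = {q_{(A,θ)} → N}`)] -/
theorem exists_ellipticCurve_degree_eq_of_primitive {q : Fin 5 → ℤ}
    (hprim : ∀ (m : ℤ) (q' : Fin 5 → ℤ), q = m • q' → m = 1 ∨ m = -1) {δ : ℤ} (hδ : 0 < δ)
    (hΔ : humbertInvariant q = δ ^ 2) (hZ : Z ∈ humbertLocus (fun i ↦ (q i : ℂ))) :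
    ∃ Y : SubtorusFrame (prinPeriod Z) 2,
      (δ : ℝ) = -prinForm Z ![latticeVec (prinPeriod Z) (Y.frame 0), latticeVec (prinPeriod Z) (Y.frame 1)] := by
  classical
  -- the class `γ_q ∈ NS(X_Z)` and its real form `D`
  have hH : humbertClass Z q ∈ hodgeClasses (prinPeriod Z) 1 :=
    humbertClass_mem_hodgeClasses (mem_humbertLocus_iff.1 hZ)
  have hIH : humbertClass Z q ∈ integralHodgeClasses (prinPeriod Z) 1 :=
    (mem_integralHodgeClasses_iff (prinPeriod Z)).2
      ⟨humbertClass_mem_integralForms Z q, ((mem_hodgeClasses_iff (prinPeriod Z)).1 hH).2⟩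
  obtain ⟨D, hDNS, hDγ⟩ := (mem_integralHodgeClasses_one_iff_exists (prinPeriod Z)).1 hIH
  have hD : IsNSForm (prinPeriod Z) D := (mem_neronSeveriGroup_iff (prinPeriod Z)).1 hDNS
  have hq : humbertVector (latticeForm Z (ofRealForm D)) = fun i ↦ (q i : ℂ) := by
    rw [hDγ, humbertVector_humbertClass]
  -- `q̃(D) = Δ(q) = δ²`, `D` primitive mod `θ_Z`
  have hqD : refinedHumbert (prinPeriod Z) stdIdx (prinForm Z) D = (δ : ℝ) ^ 2 := by
    rw [refinedHumbert_prinForm_eq_of_humbertVector_eq Z hq, hΔ, Int.cast_pow]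
  obtain ⟨W, hW, hWc, eY, hpos, hdeg⟩ :=
    ((isPrincipalPolarization_prinForm Z).exists_ellipticCurve_degree_eq_iff (prinPeriod Z) stdIdx hδ).2
      ⟨D, hD, primitive_mod_of_humbertVector_primitive Z hq hprim, hqD⟩
  refine ⟨SubtorusFrame.ofSubspace (prinPeriod Z) W hW hWc eY hpos, ?_⟩
  rw [wedgePow_one_eq_self,
    (SubtorusFrame.ofSubspace (prinPeriod Z) W hW hWc eY hpos).torusIntegral_ofRealForm_wedge_cycleForm
      (prinPeriod Z) stdIdx (-prinForm Z), Complex.ofReal_re, ContinuousAlternatingMap.neg_apply] at hdeg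
  rw [← hdeg]

/-! ## §3 An elliptic curve of degree `δ` gives a PRIMITIVE relation of invariant `δ²` -/

/-- **(⟸) An elliptic curve `Y ⊂ X_Z` of degree `δ` yields a PRIMITIVE singular relation `q = q([Y])` of `Z` with
`Δ(q) = δ²`** (row A4-61‴ `mem_humbertLocusOfInvariant_degree_sq` produced a non-trivial relation of invariant `δ²`;
primitivity is Auffarth's Lemma 3.7 / Kani — FILE 3 — transported to relations by §1).
[cite: Kani1994EllipticCurvesAbelianSurfaces] [cite: Auffarth2015EllipticCurvesAbelianVarieties, §3 Lemma 3.7 and Remark 3.2] [cite: BirkenhakeWilhelm2003, §4 proof of Prop. 4.8 (p. 1830)] -/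
theorem exists_primitive_relation_of_ellipticCurve (Y : SubtorusFrame (prinPeriod Z) 2) :
    ∃ (q : Fin 5 → ℤ) (δ : ℤ), (∀ (m : ℤ) (q' : Fin 5 → ℤ), q = m • q' → m = 1 ∨ m = -1) ∧ 0 < δ ∧
      (δ : ℝ) = -prinForm Z ![latticeVec (prinPeriod Z) (Y.frame 0), latticeVec (prinPeriod Z) (Y.frame 1)] ∧
      humbertInvariant q = δ ^ 2 ∧ Z ∈ humbertLocus (fun i ↦ (q i : ℂ)) ∧
      humbertVector (latticeForm Z (Y.cycleForm stdIdx)) = fun i ↦ (q i : ℂ) := by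
  classical
  -- present `Y` as an `ofSubspace` frame (same class)
  obtain ⟨W, hW, hWc, eY, hpos, -, hYW⟩ := Y.exists_ofSubspace_cycleForm_eq (prinPeriod Z) stdIdx
  -- FILE 3: the class `D = [Y]_NS`, primitive mod `θ_Z`, `q̃(D) = d²`, `deg = d > 0`
  obtain ⟨D, d, hD, hDγ, hind, hd, hdeg, hqD⟩ :=
    (isPrincipalPolarization_prinForm Z).exists_isNSForm_cycleForm_primitive_refinedHumbert_eq_sq (prinPeriod Z)
      W hW hWc eY hpos stdIdx
  -- its integer relation
  have hγI := ofRealForm_mem_integralForms_two (prinPeriod Z) hD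
  obtain ⟨q, hq⟩ := exists_int_humbertVector_of_mem_integralForms hγI
  have hΔ : humbertInvariant q = d ^ 2 := by
    have h := refinedHumbert_prinForm_eq_of_humbertVector_eq Z hq
    rw [hqD] at h
    exact_mod_cast h.symm
  have hrel : singularRelation (fun i ↦ (q i : ℂ)) (Z : Matrix (Fin 2) (Fin 2) ℂ) = 0 := by
    rw [← hq]
    exact (mem_hodgeClasses_iff_singularRelation_eq_zero Z (mem_rationalForms_of_mem_integralForms _ hγI)).1
      (ofRealForm_mem_hodgeClasses_one (prinPeriod Z) hD)
  -- the degree of `Y`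
  have hdeg' : (d : ℝ) = -prinForm Z ![latticeVec (prinPeriod Z) (Y.frame 0), latticeVec (prinPeriod Z) (Y.frame 1)] := by
    rw [← hYW, wedgePow_one_eq_self, Y.torusIntegral_ofRealForm_wedge_cycleForm (prinPeriod Z) stdIdx (-prinForm Z),
      Complex.ofReal_re, ContinuousAlternatingMap.neg_apply] at hdeg
    rw [← hdeg]
  refine ⟨q, d, humbertVector_primitive_of_primitive_mod Z hD hq hind, hd, hdeg', hΔ, mem_humbertLocus_iff.2 hrel, ?_⟩
  rw [hYW, ← hDγ, hq]

/-! ## §4 Kani's `H_{δ²}`: primitive relations of invariant `δ²` ⟺ elliptic curves of degree exactly `δ` -/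

/-- **`Z` satisfies a PRIMITIVE singular relation of invariant `δ²` iff `X_Z` contains an elliptic curve of degree
exactly `δ`** (`δ > 0`): Kani's Humbert surface `H_{δ²} = {⟨A,θ⟩ : q_{(A,θ)} → δ²}` (primitive representation) is the
locus of principally polarised abelian surfaces containing an elliptic curve `E` with `(E·θ) = δ` — the degree clause
"`deg L₀|E₁ = δ`" of B–W Prop. 4.8 made exact (row A4-60 had `Z ∈ ⋃_{δ>0} H_{δ²} ⟺` an elliptic curve, the degree
open). [cite: Kani1994EllipticCurvesAbelianSurfaces] [cite: Kani2016ModuliJacobiansProductElliptic, (`H_N = {⟨A,θ⟩ : q_{(A,θ)} → N}`, quoted in arXiv:2602.14319 (6.1))] [cite: BirkenhakeWilhelm2003, §4 Prop. 4.8 and its proof (p. 1830)] [cite: Auffarth2015EllipticCurvesAbelianVarieties, Thm. 1.2 (`n = 2`)] -/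
theorem exists_primitive_relation_sq_iff_exists_ellipticCurve_degree_eq {δ : ℤ} (hδ : 0 < δ) :
    (∃ q : Fin 5 → ℤ, (∀ (m : ℤ) (q' : Fin 5 → ℤ), q = m • q' → m = 1 ∨ m = -1) ∧
        humbertInvariant q = δ ^ 2 ∧ Z ∈ humbertLocus (fun i ↦ (q i : ℂ))) ↔
      ∃ Y : SubtorusFrame (prinPeriod Z) 2,
        (δ : ℝ) = -prinForm Z ![latticeVec (prinPeriod Z) (Y.frame 0), latticeVec (prinPeriod Z) (Y.frame 1)] := by
  constructor
  · rintro ⟨q, hprim, hΔ, hZ⟩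
    exact exists_ellipticCurve_degree_eq_of_primitive Z hprim hδ hΔ hZ
  · rintro ⟨Y, hY⟩
    obtain ⟨q, δ', hprim, -, hδ', hΔ, hZ, -⟩ := exists_primitive_relation_of_ellipticCurve Z Y
    have hdd : δ' = δ := by
      have h : ((δ' : ℤ) : ℝ) = δ := by rw [hδ', ← hY]
      exact_mod_cast h
    subst hdd
    exact ⟨q, hprim, hΔ, hZ⟩

/-- **A primitive relation of invariant `δ²` puts `Z` on `H_{δ²}(𝔥₂)` AND produces an elliptic curve of degree `δ`;
in particular Kani's `H_{δ²}` (primitive) is contained in B–W's `H_{δ²}(𝔥₂)`** (row A4-59 `humbertLocusOfInvariant`,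
all non-trivial relations). [cite: BirkenhakeWilhelm2003, §1 (∗) (p. 1819) and §4 Prop. 4.8] [cite: Kani2016ModuliJacobiansProductElliptic, (`H_N`)] -/
theorem mem_humbertLocusOfInvariant_of_primitive {q : Fin 5 → ℤ}
    (hprim : ∀ (m : ℤ) (q' : Fin 5 → ℤ), q = m • q' → m = 1 ∨ m = -1) {Δ : ℤ}
    (hΔ : humbertInvariant q = Δ) (hZ : Z ∈ humbertLocus (fun i ↦ (q i : ℂ))) :
    Z ∈ humbertLocusOfInvariant Δ := by
  refine mem_humbertLocusOfInvariant_iff.2 ⟨q, ?_, hΔ, hZ⟩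
  rintro rfl
  rcases hprim 0 0 (by simp) with h | h <;> simp at h

end SiegelModuli

end Literature.AlgebraicGeometry.ModuliOfAbelianVarieties

end
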